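import Summits.BirchSwinnertonDyer.BirchSwinnertonDyer.Theorems.GenusKolyvaginAtTwoOffCutResidualAtTwoRSocleSelectionHeegnerSocleSOC
import Summits.BirchSwinnertonDyer.BirchSwinnertonDyer.Theorems.GenusKolyvaginAtTwoGenusPrimitiveSupplyAtTwoPrimeTwistUnramifiedTwo
import Summits.BirchSwinnertonDyer.BirchSwinnertonDyer.Theorems.GenusKolyvaginAtTwoGenusPrimitiveSupplyAtTwoSupplyDEF1
import HarnessLib

/-!
# Route `GenusKolyvaginAtTwo`, residual `OffCutResidualAtTwoR` (stmt-BirchSwinnertonDyer-31767), LINE 27 «socle_selection» STUB S2 —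
# THE `h2K`-FREE FRAME: `DescAdmissible ∨ DescAdmissibleUnram` from the shallow Heegner frame, narrowness and the real-trivial line with NO clause on `2`
# (glued over gk2-p5 g38's prime-twist dictionary at an inert `2`, `…PrimeTwistUnramifiedTwo`)

LEAD seat `bsd-line-gk2-p1` g25 (cell `bsd-f1-sign2`), `--supports stmt-BirchSwinnertonDyer-31767 --as helper`; sequel of p776743 / p776950 / p777033.  THEOREMS
ONLY (no definition, no named fact, no `sorry`).  **BSD is NOT proved by this file; `OffCutResidualAtTwoR`, K4Pos and crux 25504 are NOT proved; S2 is NOT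
closed (its (HL) conjunct remains — gk2-p4 g30's real-visibility glue).**

* §0 `descAdmissible_or_unram_of_shallowTwin` — THE FRAME SUPPLIER: `E/ℚ` globally minimal with `C(E)` odd, `K` imaginary quadratic with odd `d_K`, Heegner
  for `N_E`, `Wd = Cd • E^{(d_K)}` with `ord₂ C(Wd) = 0` ⟹ `DescAdmissible E d_K ∨ DescAdmissibleUnram E d_K` (`2` split: gk2-p5 g34
  `descAdmissible_discr_of_allSilentTwin`; `2` inert: `d_K ≡ 5 (8)`, `2 ∤ N` so `E` is good at `2`, every prime of `d_K` silent by the Tamagawa root count,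
  gk2-p5 g7 `descAdmissibleUnram_discr_of_forall_silent`).
* §1 the `h2K`-FREE decision on the shallow `Δ > 0` frame: `twistSelmer_eq_strict_and_narrow_of_descAdmissible_or_unram`,
  `exists_localization_ne_zero_of_shallowTwin'` (NARROWNESS AUTOMATIC, no clause on `2`), `realTrivial_iff_mem_primeTwist_selmerGroup_of_descAdmissible_or_unram`,
  `natCard_realTrivial_eq_two'` — file 1's §2 over gk2-p5 g38's `primeTwist_selmerGroup_eq_relaxed_or_eq_kummerStrict_decided_of_descAdmissible_or_unram`.
* §2 (sequel file `…HeegnerSocleUnramSOC`) **`sharedSocle_of_realTrivialSocle`** — the (SOC) conjunct of `stub_shallowFrameSocle` VERBATIM.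
BSD is NOT proved by any of this.

References: [Kramer1981] Thm. 1, Prop. 3, Prop. 7; [MazurRubin2010] Lemma 2.10 (v), Def. 3.1, Lemma 3.2, Prop. 3.3; [MazurRubin2007] §3, Prop 4.1, Def 4.3;
[GrossLMS1991] §4 (4.4), §5 (5.1); [McCallumLMS1991] §4 Lemma 4.6, §5 Lemma 5.1.
-/

set_option autoImplicit false
-- the Theorems namespace of this sub repeats the summit name by design (D-0017 nested layout)
set_option linter.dupNamespace false

noncomputable section

open scoped Classical

namespace Summit.BirchSwinnertonDyer.BirchSwinnertonDyer.Theorems.GenusExact.PlusDescent.SocleSelection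

open WeierstrassCurve NumberField IsDedekindDomain Field
open Literature.NumberTheory.EllipticCurves Literature.NumberTheory.GaloisRepresentations
open Summit.BirchSwinnertonDyer.Rank1Residual.F1Sign2 (DescAdmissible DescAdmissibleUnram NoRationalTwoTorsion IsQuadraticCharacterOf
  selmerGroupRelaxedAtInfinityAtTwo selmerGroup_le_selmerGroupRelaxedAtInfinityAtTwo mem_selmerGroupRelaxedAtInfinityAtTwo_iff)
open Summit.BirchSwinnertonDyer.Rank1Residual.X11b.KummerPT (kummerStrict)
open Summit.BirchSwinnertonDyer.BirchSwinnertonDyer.Theorems.GenusKolyArch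
open Summit.BirchSwinnertonDyer.BirchSwinnertonDyer.Theorems.GenusSupplyNarrow.KFourPosCell
open Summit.BirchSwinnertonDyer.BirchSwinnertonDyer.Theorems.RankOneAtTwoOneDoor (mem_torsionLocalKer_completion_iff)
open Summit.BirchSwinnertonDyer.BirchSwinnertonDyer.Theses.GenusKolyvaginAtTwo (MultPublishedInputsAtTwo)
open Literature.NumberTheory.EllipticCurves.ModularForms Literature.NumberTheory.EllipticCurves.KolyvaginCocycle

universe u

/-! ## §0 The frame supplier: `DescAdmissible ∨ DescAdmissibleUnram` -/

section Supplier

variable (W : WeierstrassCurve ℚ) [W.IsElliptic] [W.IsGloballyMinimal] {K : Type} [Field K] [NumberField K]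

/-- **`d_K` is descent-admissible (split OR unramified form) on the shallow Heegner frame** — `C(E)` odd, `K` imaginary quadratic with odd `d_K`, Heegner for
`N_E`, `Wd = Cd • E^{(d_K)}` elliptic with `ord₂ C(Wd) = 0`; NO hypothesis on the behaviour of `2` in `K`.  If `2` splits: gk2-p5's
`descAdmissible_discr_of_allSilentTwin`.  If not: `d_K ≡ 1 (4)` with `d_K ≢ 1 (8)`, so `d_K ≡ 5 (8)`; `2 ∤ N_E` (a prime of `N_E` splits), so `E` is good at
`2`; every prime of `d_K` is silent (its factor of `∏ (#roots_q + 1) = 2^{ord₂ C(Wd)} = 1` is `1`); gk2-p5's `descAdmissibleUnram_discr_of_forall_silent`.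
BSD is NOT proved by this. [cite: Kramer1981, Prop. 3, Prop. 6] [cite: GrossLMS1991, §1] -/
theorem descAdmissible_or_unram_of_shallowTwin [NeZero (W.conductorNorm ℤ)] (hK : IsImaginaryQuadratic K) (hodd : Odd (discr K))
    (hH : SatisfiesHeegnerHypothesis (W.conductorNorm ℤ) K) (hTam : Odd W.tamagawaProduct)
    {Wd : WeierstrassCurve ℚ} [Wd.IsElliptic] (Cd : VariableChange ℚ) (hCd : Cd • W.quadraticTwist (discr K : ℚ) = Wd)
    (hDEF : padicValNat 2 Wd.tamagawaProduct = 0) :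
    DescAdmissible W (discr K) ∨ DescAdmissibleUnram W (discr K) := by
  have h2 : Module.finrank ℚ K = 2 := hK.1
  by_cases h2K : ((Ideal.span {(2 : ℤ)}).primesOver (𝓞 K)).ncard = 2
  · exact Or.inl (descAdmissible_discr_of_allSilentTwin W hK hodd hH h2K hTam Cd hCd hDEF)
  · right
    -- `d_K ≡ 5 (mod 8)`
    have h1 : ¬ discr K % 8 = 1 :=
      fun h ↦ h2K ((Literature.NumberTheory.QuadraticFields.Quadratic.ncard_primesOver_two_eq_two_iff h2).mpr h)
    have h4 : discr K % 4 = 1 := by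
      rcases Literature.NumberTheory.QuadraticFields.Quadratic.discr_emod_four h2 with h | h
      · exfalso; obtain ⟨r, hr⟩ := hodd; omega
      · exact h
    have h5 : discr K % 8 = 5 := by omega
    -- `E` is good at `2`: a bad `2` would split in `K`
    have hgood2 : ∀ _h : Fact (Nat.Prime 2), W.HasGoodReductionAtPrime 2 := by
      intro _
      by_contra hbad
      have h2N : 2 ∣ W.conductorNorm ℤ := (W.dvd_conductorNorm_iff_not_hasGoodReductionAtPrime 2).mpr hbad
      exact h2K (by simpa using hH 2 Nat.prime_two h2N)
    -- every prime of `d_K` is silent: the Tamagawa root count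
    have hprod := prod_ncard_roots_add_one_eq_two_pow_padicValNat_tamagawaProduct_twin W hK hodd hH hTam Cd hCd
    rw [hDEF, pow_zero] at hprod
    refine GenusKolyTwin.descAdmissibleUnram_discr_of_forall_silent W hK hodd hH h5 hgood2 fun q _ hqd x hx ↦ ?_
    have hq : q.Prime := Fact.out
    have hqS : q ∈ (discr K).natAbs.primeFactors :=
      Nat.mem_primeFactors.mpr ⟨hq, Int.natCast_dvd.mp (by simpa using hqd), Int.natAbs_ne_zero.mpr (NumberField.discr_ne_zero K)⟩
    have hdvd1 : ({x : ZMod q | 4 * x ^ 3 + ((integralModelInt W).b₂ : ZMod q) * x ^ 2 +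
        2 * ((integralModelInt W).b₄ : ZMod q) * x + ((integralModelInt W).b₆ : ZMod q) = 0}.ncard + 1) ∣ 1 := by
      have h := Finset.dvd_prod_of_mem (fun q : ℕ ↦ ({x : ZMod q | 4 * x ^ 3 + ((integralModelInt W).b₂ : ZMod q) * x ^ 2 +
        2 * ((integralModelInt W).b₄ : ZMod q) * x + ((integralModelInt W).b₆ : ZMod q) = 0} : Set (ZMod q)).ncard + 1) hqS
      rw [hprod] at h
      exact h
    have h0 : ({x : ZMod q | 4 * x ^ 3 + ((integralModelInt W).b₂ : ZMod q) * x ^ 2 +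
        2 * ((integralModelInt W).b₄ : ZMod q) * x + ((integralModelInt W).b₆ : ZMod q) = 0} : Set (ZMod q)).ncard = 0 := by
      have := Nat.le_of_dvd one_pos hdvd1
      omega
    have hempty := (Set.ncard_eq_zero (Set.toFinite _)).mp h0
    have hmem : x ∈ ({x : ZMod q | 4 * x ^ 3 + ((integralModelInt W).b₂ : ZMod q) * x ^ 2 +
        2 * ((integralModelInt W).b₄ : ZMod q) * x + ((integralModelInt W).b₆ : ZMod q) = 0} : Set (ZMod q)) := hx
    rw [hempty] at hmem
    exact hmem

end Supplier

/-! ## §1 The `h2K`-free decision on the shallow `Δ > 0` frame -/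

section Frame

variable (W : WeierstrassCurve ℚ) [W.IsElliptic] [W.IsGloballyMinimal] {K : Type} [Field K] [NumberField K]

/-- **THE DECISION, `h2K`-free.**  `E/ℚ` globally minimal, `Δ > 0`, `ρ̄_{E,2}` onto, `#Sel₂(E) = 4`; `K` a number field with
`DescAdmissible E d_K ∨ DescAdmissibleUnram E d_K` (§0); `Wd = Cd • E^{(d_K)}` with `#Sel₂(Wd) = 2`; `χ` the character of `d_K`: some `2`-Selmer class of
`E` is NON-trivial at `∞` and `Sel_𝔓(A_χ/ℚ) = Sel₂^{str ∞}(E)` (gk2-p5 g38's decided dichotomy; the relaxed branch has order `≥ 4 ≠ 2`).  BSD is NOT proved by this.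
[cite: Kramer1981, Thm. 1, Prop. 7] [cite: MazurRubin2010, Lemma 2.10 (v), Prop 3.3] [cite: MazurRubin2007, §3, Prop 4.1, Def 4.3] -/
theorem twistSelmer_eq_strict_and_narrow_of_descAdmissible_or_unram (hΔ : 0 < W.Δ) (hρ : W.HasSurjectiveModNGaloisRep 2)
    (h4 : Nat.card (W.selmerGroup 2) = 4) (hd : DescAdmissible W (discr K) ∨ DescAdmissibleUnram W (discr K))
    {Wd : WeierstrassCurve ℚ} [Wd.IsElliptic] (Cd : VariableChange ℚ) (hCd : Cd • W.quadraticTwist (discr K : ℚ) = Wd)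
    (hSel : Nat.card (Wd.selmerGroup 2) = 2)
    {χ : absoluteGaloisGroup ℚ →ₜ* Multiplicative (ZMod 2)} (hχ : IsQuadraticCharacterOf χ (discr K)) :
    (∃ c ∈ W.selmerGroup ((2 : ℕ) : ℤ),
        galoisCohomology.localization (W.torsionGaloisModule ((2 : ℕ) : ℤ)) (Sum.inl Rat.infinitePlace) 1 c ≠ 0) ∧
      PrimeTwist.selmerGroup W χ = (kummerStrict W 2 {(Sum.inl Rat.infinitePlace : Place ℚ)}).selmerGroup := by
  have hT : NoRationalTwoTorsion W :=
    GenusKolyTwin.noRationalTwoTorsion_of_hasSurjectiveModNGaloisRep W (by simpa using hρ)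
  rcases primeTwist_selmerGroup_eq_relaxed_or_eq_kummerStrict_decided_of_descAdmissible_or_unram W hΔ hT hd hχ Rat.infinitePlace
    with ⟨-, hR⟩ | h
  · exfalso
    have hcard : Nat.card (PrimeTwist.selmerGroup W χ) = 2 := by
      rw [natCard_primeTwist_selmerGroup_eq_natCard_selmerGroup_rat W (NumberField.discr_ne_zero K) hχ hCd]
      exact_mod_cast hSel
    have hle : W.selmerGroup ((2 : ℕ) : ℤ) ≤ PrimeTwist.selmerGroup W χ := by
      rw [hR]; exact selmerGroup_le_selmerGroupRelaxedAtInfinityAtTwo W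
    haveI : Finite (PrimeTwist.selmerGroup W χ) := Nat.finite_of_card_ne_zero (by rw [hcard]; norm_num)
    have h4' : Nat.card (W.selmerGroup ((2 : ℕ) : ℤ)) = 4 := h4
    have hle' := AddSubgroup.card_le_of_le hle
    rw [hcard, h4'] at hle'
    omega
  · exact h

/-- **NARROWNESS IS AUTOMATIC on the shallow frame — no clause on `2`** (K₄⁺ `h4` shape): `C(E)` odd, `Δ > 0`, `ρ̄_{E,2}` onto, `#Sel₂(E) = 4`, `K` imaginary
quadratic with odd `d_K`, Heegner, twin `Wd` with `ord₂ C(Wd) = 0` and `#Sel₂(Wd) = 2`.  BSD is NOT proved by this. [cite: Kramer1981, Thm. 1, Prop. 7]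
[cite: MazurRubin2010, Lemma 2.10 (v), Prop 3.3] -/
theorem exists_localization_ne_zero_of_shallowTwin' [NeZero (W.conductorNorm ℤ)] (hΔ : 0 < W.Δ) (hρ : W.HasSurjectiveModNGaloisRep 2)
    (hTam : Odd W.tamagawaProduct) (h4 : Nat.card (W.selmerGroup 2) = 4) (hK : IsImaginaryQuadratic K) (hodd : Odd (discr K))
    (hH : SatisfiesHeegnerHypothesis (W.conductorNorm ℤ) K)
    {Wd : WeierstrassCurve ℚ} [Wd.IsElliptic] (Cd : VariableChange ℚ) (hCd : Cd • W.quadraticTwist (discr K : ℚ) = Wd)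
    (hDEF : padicValNat 2 Wd.tamagawaProduct = 0) (hSel : Nat.card (Wd.selmerGroup 2) = 2) :
    Nat.card (W.selmerGroup 2) = 4 ∧ ∃ c ∈ (W.kummerSelmerStructure ((2 : ℕ) : ℤ)).selmerGroup,
      galoisCohomology.localization (W.torsionGaloisModule ((2 : ℕ) : ℤ)) (Sum.inl Rat.infinitePlace) 1 c ≠ 0 := by
  obtain ⟨χ, hχ⟩ := GenusKolyTransp.quadraticCharacterExists_holds (discr K)
  have hd := descAdmissible_or_unram_of_shallowTwin W hK hodd hH hTam Cd hCd hDEF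
  obtain ⟨⟨c, hc, hne⟩, -⟩ := twistSelmer_eq_strict_and_narrow_of_descAdmissible_or_unram W hΔ hρ h4 hd Cd hCd hSel hχ
  refine ⟨h4, c, ?_, hne⟩
  rwa [← selmerGroup_eq_selmerGroup_kummerSelmerStructure]

/-- **(A2) `h2K`-free: a class is a REAL-TRIVIAL `2`-Selmer class of `E` iff it lies in the twin's Selmer group `Sel_𝔓(A_{χ_{d_K}}/ℚ)`** (shallow frame as in
`twistSelmer_eq_strict_and_narrow_of_descAdmissible_or_unram`).  BSD is NOT proved by this. [cite: Kramer1981, Thm. 1, Prop. 7] [cite: MazurRubin2010, Def 3.1, Lemma 3.2] -/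
theorem realTrivial_iff_mem_primeTwist_selmerGroup_of_descAdmissible_or_unram (hΔ : 0 < W.Δ) (hρ : W.HasSurjectiveModNGaloisRep 2)
    (h4 : Nat.card (W.selmerGroup 2) = 4) (hd : DescAdmissible W (discr K) ∨ DescAdmissibleUnram W (discr K))
    {Wd : WeierstrassCurve ℚ} [Wd.IsElliptic] (Cd : VariableChange ℚ) (hCd : Cd • W.quadraticTwist (discr K : ℚ) = Wd)
    (hSel : Nat.card (Wd.selmerGroup 2) = 2)
    {χ : absoluteGaloisGroup ℚ →ₜ* Multiplicative (ZMod 2)} (hχ : IsQuadraticCharacterOf χ (discr K))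
    (s : galH1Torsion W ((2 : ℕ) : ℤ)) :
    (s ∈ W.selmerGroup ((2 : ℕ) : ℤ) ∧ ∀ w : InfinitePlace ℚ, s ∈ W.torsionLocalKer w.Completion ((2 : ℕ) : ℤ)) ↔
      s ∈ PrimeTwist.selmerGroup W χ := by
  obtain ⟨-, hstrict⟩ := twistSelmer_eq_strict_and_narrow_of_descAdmissible_or_unram W hΔ hρ h4 hd Cd hCd hSel hχ
  have hkey : s ∈ PrimeTwist.selmerGroup W χ ↔
      s ∈ selmerGroupRelaxedAtInfinityAtTwo W ∧
        galoisCohomology.localization (W.torsionGaloisModule ((2 : ℕ) : ℤ)) (Sum.inl Rat.infinitePlace) 1 s = 0 := by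
    rw [hstrict]; exact mem_selmerGroup_kummerStrict_singleton_inl_iff W Rat.infinitePlace s
  have htk : ∀ w : InfinitePlace ℚ, s ∈ W.torsionLocalKer w.Completion ((2 : ℕ) : ℤ) ↔
      galoisCohomology.localization (W.torsionGaloisModule ((2 : ℕ) : ℤ)) (Sum.inl w) 1 s = 0 :=
    fun w ↦ mem_torsionLocalKer_completion_iff W w two_ne_zero s
  rw [hkey]
  constructor
  · rintro ⟨hs, hinf⟩
    exact ⟨selmerGroup_le_selmerGroupRelaxedAtInfinityAtTwo W hs, (htk _).mp (hinf _)⟩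
  · rintro ⟨hrel, h0⟩
    have hinf : ∀ w : InfinitePlace ℚ, s ∈ W.torsionLocalKer w.Completion ((2 : ℕ) : ℤ) := by
      intro w
      rw [Subsingleton.elim w Rat.infinitePlace]
      exact (htk _).mpr h0
    refine ⟨?_, hinf⟩
    rw [mem_selmerGroup_iff]
    refine ⟨(mem_selmerGroupRelaxedAtInfinityAtTwo_iff W s).mp hrel, fun w ↦ ?_⟩
    exact W.torsionLocalKer_le_selmerLocalKer w.Completion ((2 : ℕ) : ℤ) (hinf w)

/-- **(A2, counted, `h2K`-free) the real-trivial `2`-Selmer classes of `E` are exactly TWO** on the shallow frame.  BSD is NOT proved by this.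
[cite: Kramer1981, Thm. 1] [cite: MazurRubin2007, §3, Prop 4.1, Def 4.3] -/
theorem natCard_realTrivial_eq_two' [NeZero (W.conductorNorm ℤ)] (hΔ : 0 < W.Δ) (hρ : W.HasSurjectiveModNGaloisRep 2)
    (hTam : Odd W.tamagawaProduct) (h4 : Nat.card (W.selmerGroup 2) = 4) (hK : IsImaginaryQuadratic K) (hodd : Odd (discr K))
    (hH : SatisfiesHeegnerHypothesis (W.conductorNorm ℤ) K)
    {Wd : WeierstrassCurve ℚ} [Wd.IsElliptic] (Cd : VariableChange ℚ) (hCd : Cd • W.quadraticTwist (discr K : ℚ) = Wd)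
    (hDEF : padicValNat 2 Wd.tamagawaProduct = 0) (hSel : Nat.card (Wd.selmerGroup 2) = 2) :
    Nat.card {s : galH1Torsion W ((2 : ℕ) : ℤ) //
        s ∈ W.selmerGroup ((2 : ℕ) : ℤ) ∧ ∀ w : InfinitePlace ℚ, s ∈ W.torsionLocalKer w.Completion ((2 : ℕ) : ℤ)} = 2 := by
  obtain ⟨χ, hχ⟩ := GenusKolyTransp.quadraticCharacterExists_holds (discr K)
  have hd := descAdmissible_or_unram_of_shallowTwin W hK hodd hH hTam Cd hCd hDEF
  have hiff := realTrivial_iff_mem_primeTwist_selmerGroup_of_descAdmissible_or_unram W hΔ hρ h4 hd Cd hCd hSel hχ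
  rw [Nat.card_congr (Equiv.subtypeEquivRight hiff)]
  change Nat.card (PrimeTwist.selmerGroup W χ) = 2
  rw [natCard_primeTwist_selmerGroup_eq_natCard_selmerGroup_rat W (NumberField.discr_ne_zero K) hχ hCd]
  exact_mod_cast hSel

end Frame

end Summit.BirchSwinnertonDyer.BirchSwinnertonDyer.Theorems.GenusExact.PlusDescent.SocleSelection

end
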